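import Mathlib

/-!
# Russo telescoping of first-contact events (measure-theoretic skeleton)
# (helper for `DensityIntegration`, item stmt-CriticalPhenomena-14890, route CardyBoundaryCoulombGas)

Along the lattice boundary arc `c = v₀, v₁, …, v_L` the mark density at the sink `v_j` is the
probability of the rainbow event `{v_{j+1} ↔ [a,b]} ∩ {v₀, …, v_j ↮ [a,b]}` = "`v_{j+1}` is the
first vertex of the arc joined to `[a,b]`". Summing over `j` telescopes to
`P[some v_i, i ≤ L, is joined to [a,b]] − P[v₀ is joined to [a,b]]`. This file proves that identity
for an arbitrary finite measure and an arbitrary sequence of measurable events `A i = {v_i ↔ [a,b]}`.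
-/

noncomputable section

open Set MeasureTheory Finset

namespace Summit.CriticalPhenomena.CardyFormulaZ2.Theorems

variable {Ω : Type*}

/-- The events "some `A i`, `i ≤ j`, occurs" increase with `j`, and consecutive differences are the
first-occurrence events `A (j+1) ∩ ⋂_{i ≤ j} (A i)ᶜ`. [folklore] -/
theorem biUnion_succ_diff_eq (A : ℕ → Set Ω) (j : ℕ) :
    (⋃ i ∈ Finset.range (j + 2), A i) \ (⋃ i ∈ Finset.range (j + 1), A i) =
      A (j + 1) ∩ ⋂ i ∈ Finset.range (j + 1), (A i)ᶜ := by
  ext ω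
  simp only [Set.mem_sdiff, Set.mem_iUnion, Finset.mem_range, exists_prop, not_exists, not_and,
    Set.mem_inter_iff, Set.mem_iInter, Set.mem_compl_iff]
  constructor
  · rintro ⟨⟨i, hi, hω⟩, hnot⟩
    refine ⟨?_, fun i hi' ↦ hnot i hi'⟩
    rcases Nat.lt_succ_iff_lt_or_eq.1 hi with h | h
    · exact absurd hω (hnot i h)
    · exact h ▸ hω
  · rintro ⟨hω, hnot⟩
    exact ⟨⟨j + 1, Nat.lt_succ_self _, hω⟩, hnot⟩

/-- **Russo telescoping.** For a finite measure `μ` and measurable events `A i`,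
`μ(⋃_{i ≤ L} A i) − μ(A 0) = Σ_{j < L} μ(A (j+1) ∩ ⋂_{i ≤ j} (A i)ᶜ)`: the probability that some
`A i` occurs, minus that of `A 0`, is the sum over `j` of the probabilities that `A (j+1)` is the
FIRST to occur (Russo's formula in the position of a boundary mark; Grimmett 1999 §2.4 in spirit). [folklore] -/
theorem measureReal_biUnion_sub_eq_sum_first [MeasurableSpace Ω] (μ : Measure Ω) [IsFiniteMeasure μ]
    (A : ℕ → Set Ω)
    (hA : ∀ i, MeasurableSet (A i)) (L : ℕ) :
    μ.real (⋃ i ∈ Finset.range (L + 1), A i) - μ.real (A 0) =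
      ∑ j ∈ Finset.range L, μ.real (A (j + 1) ∩ ⋂ i ∈ Finset.range (j + 1), (A i)ᶜ) := by
  induction L with
  | zero => simp
  | succ L ih =>
    rw [Finset.sum_range_succ, ← ih]
    have hmeas : ∀ n, MeasurableSet (⋃ i ∈ Finset.range n, A i) := fun n ↦
      Finset.measurableSet_biUnion _ fun i _ ↦ hA i
    have hsub : (⋃ i ∈ Finset.range (L + 1), A i) ⊆ ⋃ i ∈ Finset.range (L + 2), A i := by
      refine Set.iUnion₂_subset fun i hi ↦ ?_
      exact Set.subset_iUnion₂ (s := fun i _ ↦ A i) i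
        (Finset.mem_range.2 ((Finset.mem_range.1 hi).trans (Nat.lt_succ_self _)))
    have hdiff := measureReal_sdiff (μ := μ) hsub (hmeas (L + 1)) (measure_ne_top μ _)
    rw [biUnion_succ_diff_eq] at hdiff
    rw [show L + 1 + 1 = L + 2 from rfl, hdiff]
    ring

end Summit.CriticalPhenomena.CardyFormulaZ2.Theorems

end
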